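import Literature.AlgebraicGeometry.Motives.HypersurfaceSplitLinearSections
import Literature.RingTheory.MvPolynomial.CubicFormNonIsotropicPlanePair
import HarnessLib

/-!
# The class `H_X^{d-2} ∩ [X]` of a smooth cubic hypersurface is a sum of three plane classes

R. Mboro, *Remarks on the `CH₂` of cubic hypersurfaces* (arXiv:1701.04488), proof of Prop. 1.4
(p. 8: "`S := P₀ ∩ X` is a cubic surface … `H_X^{n-2} = [S]`") and proof of Thm. 1.3 (p. 8:
"`𝒫` is in `Im(P_*)`"): the class of a `3`-plane section of the cubic `X` is accounted for by linear
subspaces. This file proves the elementary version used to pass from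
`CH₂(X) = ℤ · H_X^{d-2} + ⟨planes⟩` (`Motives/TangentLinesChowTwo`) to `CH₂(X) = ⟨planes⟩`:

* `Hypersurface.hyperplaneSectionOnIter_two_mem_closure_linearSubspaceClasses` — **for a cubic
  hypersurface `X = V₊(F) ⊆ ℙᵈ⁺¹_k` (`k` algebraically closed, `d ≥ 11`) whose equation has
  non-vanishing gradient at every non-zero zero (e.g. `X` smooth, by the Jacobian criterion
  `Motives/SmoothHypersurfaceJacobianCriterion`), the class `c₁(𝒪_X(1))^{d-2} ∩ [X] ∈ CH₂(X)` lies
  in the subgroup generated by the plane classes.** Indeed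
  `Literature.RingTheory.MvPolynomial.exists_nonIsotropic_plane_pair` gives two planes
  `Π = ℙ(span(a,b,y))`, `Π' = ℙ(span(a,b,w))` of `X` meeting in a line whose span
  `M = ℙ(span(a,b,y,w))` is a `3`-plane NOT on `X`; then `X ∩ M = Π ∪ Π' ∪ Π''` with a residual
  plane `Π''` and `[Π] + [Π'] + [Π''] = c₁(𝒪_X(1))^{d-2} ∩ [X]`
  (`Hypersurface.exists_residual_plane_of_cubic`, `Motives/HypersurfaceSplitLinearSections`).

The rest of the file is the linear algebra turning the four vectors into the equations
`L, ℓ, ℓ'` of `M, Π, Π'` (`exists_linearForm_vanishing_eval_ne_zero`,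
`mem_idealSpan_of_forall_mem_span_eval_eq_zero`). Everything is proved; no named facts.

## References

* [Mboro2018] R. Mboro, Remarks on the CH₂ of cubic hypersurfaces, arXiv:1701.04488, proofs of
  Prop. 1.4 and Thm. 1.3 (p. 8).
* [Fulton1998] W. Fulton, Intersection Theory, 2nd ed. (1998), Prop. 2.3 (b), Example 2.5.1.
-/

noncomputable section

open CategoryTheory AlgebraicGeometry Order MvPolynomial
open Literature.AlgebraicGeometry.Motives.Segre

universe u

namespace Literature.AlgebraicGeometry.Motives

attribute [local instance] MvPolynomial.gradedAlgebra

/-! ### Linear algebra: equations of the planes and of their span -/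

namespace ProjSpace

open ProjectiveSpace ProjectiveSpaceCells Literature.RingTheory.MvPolynomial

variable {K : Type u} [Field K] [Infinite K] {N : ℕ}

/-- **A linear form vanishing on `span(x)` but not at `w ∉ span(x)`**: among the `N + 1 - u`
independent linear forms cutting out `span(x₁, …, x_u)` some one does not vanish at `w` (otherwise
they would all vanish on the larger space `span(x, w)`, whose linear forms span a space of
dimension `N - u` only). [folklore] -/
theorem exists_linearForm_vanishing_eval_ne_zero {u : ℕ} {x : Fin u → Fin (N + 1) → K}
    (hx : LinearIndependent K x) {w : Fin (N + 1) → K} (hw : w ∉ Submodule.span K (Set.range x)) :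
    ∃ lam : MvPolynomial (Fin (N + 1)) K, lam.IsHomogeneous 1 ∧
      (∀ v ∈ Submodule.span K (Set.range x), eval v lam = 0) ∧ eval w lam ≠ 0 := by
  classical
  obtain ⟨t, L, htu, hLlin, hLhom, hLvan, -⟩ := exists_linearForms_forall_mem_ideal_span_vanishing hx
  by_contra hall
  simp only [not_exists, not_and, not_not] at hall
  have hLw : ∀ j, eval w (L j) = 0 := fun j => hall (L j) (hLhom j) (hLvan j)
  -- the larger frame `(x, w)`
  have hxw : LinearIndependent K (Fin.snoc x w) := linearIndependent_finSnoc.2 ⟨hx, hw⟩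
  obtain ⟨t', L', ht'u, hL'lin, hL'hom, -, hL'ideal⟩ :=
    exists_linearForms_forall_mem_ideal_span_vanishing hxw
  -- every `L j` vanishes on `span(x, w)`, hence lies in the `K`-span of the `L'`
  have hmem : ∀ j, L j ∈ Submodule.span K (Set.range L') := by
    intro j
    refine mem_span_of_mem_idealSpan_of_linear L' hL'hom (hL'ideal _ ?_) (hLhom j)
    refine forall_mem_span_eval_eq_zero_of_isHomogeneous_one (hLhom j) ?_
    rintro _ ⟨i, rfl⟩
    refine Fin.lastCases ?_ (fun i' => ?_) i
    · rw [Fin.snoc_last]; exact hLw j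
    · rw [Fin.snoc_castSucc]; exact hLvan j _ (Submodule.subset_span ⟨i', rfl⟩)
  have hle : Submodule.span K (Set.range L) ≤ Submodule.span K (Set.range L') :=
    Submodule.span_le.mpr (by rintro _ ⟨j, rfl⟩; exact hmem j)
  have h1 : Module.finrank K (Submodule.span K (Set.range L)) = t := by
    rw [finrank_span_eq_card hLlin, Fintype.card_fin]
  have h2 : Module.finrank K (Submodule.span K (Set.range L')) = t' := by
    rw [finrank_span_eq_card hL'lin, Fintype.card_fin]
  haveI : Module.Finite K (Submodule.span K (Set.range L')) :=
    FiniteDimensional.span_of_finite K (Set.finite_range L')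
  have h3 := Submodule.finrank_mono hle
  rw [h1, h2] at h3
  omega

/-- **A form vanishing on `span(x)` lies in the ideal of any `N + 1 - u` independent linear forms
vanishing on `span(x)`** (they span the same space of linear forms as the coordinate forms of
`exists_linearForms_forall_mem_ideal_span_vanishing`, which have the ideal property). [folklore] -/
theorem mem_idealSpan_of_forall_mem_span_eval_eq_zero {u t : ℕ} {x : Fin u → Fin (N + 1) → K}
    (hx : LinearIndependent K x) {G : Fin t → MvPolynomial (Fin (N + 1)) K} (hGlin : LinearIndependent K G)
    (hGhom : ∀ j, (G j).IsHomogeneous 1)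
    (hGvan : ∀ j, ∀ v ∈ Submodule.span K (Set.range x), eval v (G j) = 0) (htu : t + u = N + 1)
    {F : MvPolynomial (Fin (N + 1)) K} (hF : ∀ v ∈ Submodule.span K (Set.range x), eval v F = 0) :
    F ∈ Ideal.span (Set.range G) := by
  classical
  obtain ⟨t', L, ht'u, hLlin, hLhom, -, hLideal⟩ := exists_linearForms_forall_mem_ideal_span_vanishing hx
  obtain rfl : t' = t := by omega
  -- `K`-span `G` = `K`-span `L`
  have hle : Submodule.span K (Set.range G) ≤ Submodule.span K (Set.range L) :=
    Submodule.span_le.mpr (by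
      rintro _ ⟨j, rfl⟩
      exact mem_span_of_mem_idealSpan_of_linear L hLhom (hLideal _ (hGvan j)) (hGhom j))
  haveI : Module.Finite K (Submodule.span K (Set.range L)) :=
    FiniteDimensional.span_of_finite K (Set.finite_range L)
  have heq : Submodule.span K (Set.range G) = Submodule.span K (Set.range L) := by
    refine Submodule.eq_of_le_of_finrank_eq hle ?_
    rw [finrank_span_eq_card hGlin, finrank_span_eq_card hLlin]
  -- `(L) ≤ (G)` as ideals
  have hLG : Ideal.span (Set.range L) ≤ Ideal.span (Set.range G) := by
    rw [Ideal.span_le]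
    rintro _ ⟨j, rfl⟩
    have hj : L j ∈ Submodule.span K (Set.range G) := by
      rw [heq]; exact Submodule.subset_span ⟨j, rfl⟩
    obtain ⟨cf, hcf⟩ := (Submodule.mem_span_range_iff_exists_fun K).1 hj
    rw [SetLike.mem_coe, ← hcf]
    refine Ideal.sum_mem _ fun j' _ => ?_
    rw [smul_eq_C_mul]
    exact Ideal.mul_mem_left _ _ (Ideal.subset_span ⟨j', rfl⟩)
  exact hLG (hLideal F hF)

omit [Infinite K] in
/-- A member of the ideal of forms vanishing at `w` vanishes at `w`. [folklore] -/
theorem eval_eq_zero_of_mem_idealSpan_of_forall {t : ℕ} {G : Fin t → MvPolynomial (Fin (N + 1)) K}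
    {w : Fin (N + 1) → K} (hGw : ∀ j, eval w (G j) = 0) {F : MvPolynomial (Fin (N + 1)) K}
    (hF : F ∈ Ideal.span (Set.range G)) : eval w F = 0 := by
  classical
  obtain ⟨cf, hcf⟩ := Ideal.mem_span_range_iff_exists_fun.1 hF
  rw [← hcf, map_sum]
  refine Finset.sum_eq_zero fun j _ => ?_
  rw [map_mul, hGw j, mul_zero]

omit [Infinite K] in
/-- Homogeneity of an extended family of linear forms. [folklore] -/
theorem isHomogeneous_one_snoc {t : ℕ} {L : Fin t → MvPolynomial (Fin (N + 1)) K}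
    (hL : ∀ j, (L j).IsHomogeneous 1) {ℓ : MvPolynomial (Fin (N + 1)) K} (hℓ : ℓ.IsHomogeneous 1) :
    ∀ j, (Fin.snoc (α := fun _ => MvPolynomial (Fin (N + 1)) K) L ℓ j).IsHomogeneous 1 := by
  intro j
  refine Fin.lastCases ?_ (fun j' => ?_) j
  · rw [Fin.snoc_last]; exact hℓ
  · rw [Fin.snoc_castSucc]; exact hL j'

end ProjSpace

/-! ### The `3`-plane section splits into three planes -/

namespace Hypersurface

open ProjSpace ProjectiveSpace ProjectiveSpaceCells Literature.RingTheory.MvPolynomial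

variable {K : Type u} [Field K] [IsAlgClosed K] {d : ℕ} {X : SchemeOver K} [IsIntegral X.left]
  [LocallyOfFiniteType X.hom] (i : X ⟶ projectiveSpace (d + 1) K) [IsClosedImmersion i.left]
  {F : MvPolynomial (Fin (d + 1 + 1)) K}

/-- **`c₁(𝒪_X(1))^{d-2} ∩ [X]` is a sum of three plane classes on a smooth cubic hypersurface of
dimension `d ≥ 11`** (Mboro, proofs of Prop. 1.4 and Thm. 1.3: the `3`-plane sections and the
planes of `X` in `Im(P_*)`). Let `X = V₊(F) ⊆ ℙᵈ⁺¹_k` be a cubic hypersurface over an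
algebraically closed field (`F` prime, `d ≥ 11`) such that the gradient of `F` vanishes at no
non-zero zero of `F`. Then for every hyperplane `V₊(ℓ₀) ⊅ X` and `2 + c = d`, the class
`hyperplaneSectionOnIter i … 2 c [X] = c₁(𝒪_X(1))ᶜ ∩ [X] ∈ CH₂(X)` lies in the subgroup generated
by the classes of the planes of `X`: two planes of `X` meeting in a line span a `3`-plane `M ⊄ X`
(`exists_nonIsotropic_plane_pair`) and `X ∩ M` is their union with a third, residual, plane
(`exists_residual_plane_of_cubic`). [cite: Mboro2018, proofs of Prop. 1.4 and Thm. 1.3 (arXiv:1701.04488, p. 8)] [cite: Fulton1998, Prop. 2.3 (b) and Example 2.5.1] -/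
theorem hyperplaneSectionOnIter_two_mem_closure_linearSubspaceClasses (hd : 11 ≤ d)
    (hF : F ∈ grading (Fin (d + 1 + 1)) K 3) (hprime : Prime F)
    (hrange : Set.range i.left.base =
      ProjectiveSpectrum.zeroLocus (MvPolynomial.homogeneousSubmodule (Fin (d + 1 + 1)) K) {F})
    (hJ : ∀ z : Fin (d + 1 + 1) → K, z ≠ 0 → eval z F = 0 → ∃ j, eval z (pderiv j F) ≠ 0)
    {c : ℕ} (hdim : 2 + c = d) {ℓ₀ : MvPolynomial (Fin (d + 1 + 1)) K}
    (hℓ₀ : ℓ₀ ∈ grading (Fin (d + 1 + 1)) K 1) (hℓ₀0 : ℓ₀ ≠ 0)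
    (hX₀ : (formDivisor ℓ₀ hℓ₀ hℓ₀0).Avoids (i.left.base (genericPoint ↥X.left))) :
    hyperplaneSectionOnIter i hℓ₀ hℓ₀0 hX₀ 2 c
        (ChowGroup.mk X.left (2 + c) ⟨primeCycle (genericPoint ↥X.left), primeCycle_mem_cyclesOfDim
          (by rw [Hypersurface.height_genericPoint i hF hprime hrange]; exact_mod_cast hdim.symm)⟩) ∈
      AddSubgroup.closure (linearSubspaceClasses 2 (d + 1) i) := by
  classical
  have hF3 : F.IsHomogeneous 3 := (mem_homogeneousSubmodule 3 F).1 hF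
  -- two planes in a line with non-isotropic span
  obtain ⟨a, b, y, w, hind, hiso₁, hiso₂, v, hvU, hFv⟩ :=
    exists_nonIsotropic_plane_pair (N := d + 1) (by omega) hF3 hJ
  -- the sub-frames
  have h3 : (![a, b, y] : Fin 3 → Fin (d + 1 + 1) → K) = ![a, b, y, w] ∘ Fin.castSucc := by
    ext j x; fin_cases j <;> rfl
  have h3' : (![a, b, w] : Fin 3 → Fin (d + 1 + 1) → K) = ![a, b, w, y] ∘ Fin.castSucc := by
    ext j x; fin_cases j <;> rfl
  have hswap : (![a, b, w, y] : Fin 4 → Fin (d + 1 + 1) → K) = ![a, b, y, w] ∘ Equiv.swap 2 3 := by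
    ext j x; fin_cases j <;> rfl
  have hind' : LinearIndependent K ![a, b, w, y] := by
    rw [hswap]; exact hind.comp _ (Equiv.injective _)
  have hx₁ : LinearIndependent K ![a, b, y] := by
    rw [h3]; exact hind.comp _ (Fin.castSucc_injective 3)
  have hx₂ : LinearIndependent K ![a, b, w] := by
    rw [h3']; exact hind'.comp _ (Fin.castSucc_injective 3)
  have hsnoc : (![a, b, y, w] : Fin 4 → Fin (d + 1 + 1) → K) = Fin.snoc ![a, b, y] w := by
    ext j x; fin_cases j <;> rfl
  have hsnoc' : (![a, b, w, y] : Fin 4 → Fin (d + 1 + 1) → K) = Fin.snoc ![a, b, w] y := by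
    ext j x; fin_cases j <;> rfl
  have hw₁ : w ∉ Submodule.span K (Set.range ![a, b, y]) := by
    have h := hind; rw [hsnoc, linearIndependent_finSnoc] at h; exact h.2
  have hy₂ : y ∉ Submodule.span K (Set.range ![a, b, w]) := by
    have h := hind'; rw [hsnoc', linearIndependent_finSnoc] at h; exact h.2
  -- sub-spans
  let U : Submodule K (Fin (d + 1 + 1) → K) := Submodule.span K (Set.range ![a, b, y, w])
  have hU₁ : Submodule.span K (Set.range ![a, b, y]) ≤ U :=
    Submodule.span_mono (by rw [h3]; exact Set.range_comp_subset_range _ _)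
  have hU₂ : Submodule.span K (Set.range ![a, b, w]) ≤ U := by
    refine Submodule.span_mono ?_
    rw [h3', hswap]
    exact (Set.range_comp_subset_range _ _).trans (Set.range_comp_subset_range _ _)
  have hwU : w ∈ U := Submodule.subset_span ⟨3, rfl⟩
  have hyU : y ∈ U := Submodule.subset_span ⟨2, rfl⟩
  have hwU₂ : w ∈ Submodule.span K (Set.range ![a, b, w]) := Submodule.subset_span ⟨2, rfl⟩
  have hyU₁ : y ∈ Submodule.span K (Set.range ![a, b, y]) := Submodule.subset_span ⟨2, rfl⟩
  -- the equations `L` of `M = ℙ(U)`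
  obtain ⟨c', L, hc', hLlin, hLhom, hLvan, -⟩ := exists_linearForms_forall_mem_ideal_span_vanishing hind
  obtain rfl : c = c' := by omega
  have hL : ∀ j, L j ∈ grading (Fin (d + 1 + 1)) K 1 := fun j => (mem_homogeneousSubmodule 1 _).2 (hLhom j)
  -- `ℓ`: vanishing on `U₁ = span(a, b, y)`, not at `w`; `ℓ'`: vanishing on `U₂ = span(a, b, w)`, not at `y`
  obtain ⟨ℓ, hℓhom, hℓvan, hℓw⟩ := exists_linearForm_vanishing_eval_ne_zero hx₁ hw₁
  obtain ⟨ℓ', hℓ'hom, hℓ'van, hℓ'y⟩ := exists_linearForm_vanishing_eval_ne_zero hx₂ hy₂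
  have hℓg : ℓ ∈ grading (Fin (d + 1 + 1)) K 1 := (mem_homogeneousSubmodule 1 _).2 hℓhom
  have hℓ'g : ℓ' ∈ grading (Fin (d + 1 + 1)) K 1 := (mem_homogeneousSubmodule 1 _).2 hℓ'hom
  -- independence of `(L, ℓ)` and `(L, ℓ')`
  have hnotspan : ∀ {m : MvPolynomial (Fin (d + 1 + 1)) K} {p : Fin (d + 1 + 1) → K}, p ∈ U →
      eval p m ≠ 0 → m ∉ Submodule.span K (Set.range L) := by
    intro m p hp hm hmem
    apply hm
    obtain ⟨cf, hcf⟩ := (Submodule.mem_span_range_iff_exists_fun K).1 hmem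
    rw [← hcf, map_sum]
    refine Finset.sum_eq_zero fun j _ => ?_
    rw [smul_eq_C_mul, map_mul, hLvan j p hp, mul_zero]
  have hLℓlin : LinearIndependent K (Fin.snoc L ℓ) := linearIndependent_finSnoc.2 ⟨hLlin, hnotspan hwU hℓw⟩
  have hLℓ'lin : LinearIndependent K (Fin.snoc L ℓ') := linearIndependent_finSnoc.2 ⟨hLlin, hnotspan hyU hℓ'y⟩
  have hLℓhom := isHomogeneous_one_snoc hLhom hℓhom
  have hLℓ'hom := isHomogeneous_one_snoc hLhom hℓ'hom
  -- vanishing of the extended families on `U₁`, `U₂`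
  have hLℓvan : ∀ j, ∀ p ∈ Submodule.span K (Set.range ![a, b, y]),
      eval p (Fin.snoc (α := fun _ => MvPolynomial (Fin (d + 1 + 1)) K) L ℓ j) = 0 := by
    intro j p hp
    refine Fin.lastCases ?_ (fun j' => ?_) j
    · rw [Fin.snoc_last]; exact hℓvan p hp
    · rw [Fin.snoc_castSucc]; exact hLvan j' p (hU₁ hp)
  have hLℓ'van : ∀ j, ∀ p ∈ Submodule.span K (Set.range ![a, b, w]),
      eval p (Fin.snoc (α := fun _ => MvPolynomial (Fin (d + 1 + 1)) K) L ℓ' j) = 0 := by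
    intro j p hp
    refine Fin.lastCases ?_ (fun j' => ?_) j
    · rw [Fin.snoc_last]; exact hℓ'van p hp
    · rw [Fin.snoc_castSucc]; exact hLvan j' p (hU₂ hp)
  -- `F ∈ (L, ℓ)` and `F ∈ (L, ℓ')`
  have hF₁ : F ∈ Ideal.span (Set.range (Fin.snoc L ℓ)) :=
    mem_idealSpan_of_forall_mem_span_eval_eq_zero hx₁ hLℓlin hLℓhom hLℓvan (by omega) hiso₁
  have hF₂ : F ∈ Ideal.span (Set.range (Fin.snoc L ℓ')) :=
    mem_idealSpan_of_forall_mem_span_eval_eq_zero hx₂ hLℓ'lin hLℓ'hom hLℓ'van (by omega) hiso₂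
  -- `ℓ ∉ (L, ℓ')`: everything there vanishes at `w`, `ℓ` does not
  have hℓℓ' : ℓ ∉ Ideal.span (Set.range (Fin.snoc L ℓ')) := fun hmem =>
    hℓw (eval_eq_zero_of_mem_idealSpan_of_forall (fun j => hLℓ'van j w hwU₂) hmem)
  -- `F ∉ (L)`: `F` does not vanish on `U`
  have hFL : F ∉ Ideal.span (Set.range L) := fun hmem =>
    hFv (eval_eq_zero_of_mem_idealSpan_of_forall (fun j => hLvan j v hvU) hmem)
  -- the points: generic point of `M`, and the two planes on `X`
  obtain ⟨pM, hpM, -, -⟩ := exists_point_of_linearIndependent L hLlin hLhom (by omega)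
  have hFpM : F ∉ ProjectiveSpectrum.asHomogeneousIdeal
      (𝒜 := MvPolynomial.homogeneousSubmodule (Fin (d + 1 + 1)) K) pM := by
    intro h
    apply hFL
    rw [← hpM]
    exact h
  have hplane : ∀ (m : MvPolynomial (Fin (d + 1 + 1)) K) (hm : LinearIndependent K (Fin.snoc L m))
      (hmhom : ∀ j, (Fin.snoc (α := fun _ => MvPolynomial (Fin (d + 1 + 1)) K) L m j).IsHomogeneous 1),
      F ∈ Ideal.span (Set.range (Fin.snoc L m)) →
      ∃ z : ↥X.left, (ProjectiveSpectrum.asHomogeneousIdeal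
        (𝒜 := MvPolynomial.homogeneousSubmodule (Fin (d + 1 + 1)) K) (i.left.base z)).toIdeal =
          Ideal.span (Set.range (Fin.snoc L m)) ∧ IsLinearSubspacePoint 2 (d + 1) i z := by
    intro m hm hmhom hFm
    obtain ⟨p, hp, -, -⟩ := exists_point_of_linearIndependent (Fin.snoc L m) hm hmhom (by omega)
    have hpX : p ∈ Set.range i.left.base := by
      rw [hrange]
      intro G hG
      rw [Set.mem_singleton_iff.mp hG]
      change F ∈ (ProjectiveSpectrum.asHomogeneousIdeal
        (𝒜 := MvPolynomial.homogeneousSubmodule (Fin (d + 1 + 1)) K) p).toIdeal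
      rw [hp]
      exact hFm
    obtain ⟨z, hz⟩ := hpX
    have hz' : (ProjectiveSpectrum.asHomogeneousIdeal
        (𝒜 := MvPolynomial.homogeneousSubmodule (Fin (d + 1 + 1)) K) (i.left.base z)).toIdeal =
          Ideal.span (Set.range (Fin.snoc L m)) := by rw [hz]; exact hp
    refine ⟨z, hz', ?_⟩
    have h := isLinearSubspacePoint_of_toIdeal_base_eq_span (i := i) (Fin.snoc L m) hm hmhom (by omega) hz'
    rwa [show d + 1 - (c + 1) = 2 by omega] at h
  obtain ⟨z₁, hz₁, hz₁pl⟩ := hplane ℓ hLℓlin hLℓhom hF₁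
  obtain ⟨z₂, hz₂, hz₂pl⟩ := hplane ℓ' hLℓ'lin hLℓ'hom hF₂
  -- the hyperplanes `V₊(L_j)` do not contain `X`
  have hav : ∀ j, (formDivisor (L j) (hL j) (hLlin.ne_zero j)).Avoids (i.left.base (genericPoint ↥X.left)) := by
    intro j
    refine formDivisor_avoids_base_genericPoint i hF hprime hrange (hL j) (hLlin.ne_zero j) fun h => hFL ?_
    exact Ideal.span_mono (Set.singleton_subset_iff.2 (Set.mem_range_self j)) h
  -- the residual plane and the class identity
  obtain ⟨q, z₃, h₁, h₂, h₃, hq, hz₃, -, hsum⟩ := exists_residual_plane_of_cubic i hF hprime hrange rfl hdim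
    L hL hLlin hav hpM hFpM hℓg hℓ'g hℓℓ' z₁ z₂ hz₁ hz₂ hℓ₀ hℓ₀0 hX₀
  have hqlin : LinearIndependent K (Fin.snoc L q) := by
    refine linearIndependent_finSnoc.2 ⟨hLlin, fun hmem => ?_⟩
    -- `(L, q) = (L)` would put the plane `closure {z₃}` inside `M`'s equations only: dimension
    have hzspan : (ProjectiveSpectrum.asHomogeneousIdeal
        (𝒜 := MvPolynomial.homogeneousSubmodule (Fin (d + 1 + 1)) K) (i.left.base z₃)).toIdeal =
          Ideal.span (Set.range L) := by
      rw [hz₃, Fin.range_snoc]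
      refine le_antisymm ?_ (Ideal.span_mono (Set.subset_insert _ _))
      rw [Ideal.span_le, Set.insert_subset_iff]
      refine ⟨?_, Ideal.subset_span⟩
      obtain ⟨cf, hcf⟩ := (Submodule.mem_span_range_iff_exists_fun K).1 hmem
      rw [SetLike.mem_coe, ← hcf]
      refine Ideal.sum_mem _ fun j _ => ?_
      rw [smul_eq_C_mul]
      exact Ideal.mul_mem_left _ _ (Ideal.subset_span ⟨j, rfl⟩)
    have hh := (ProjSpace.isLinearSubspacePoint_of_toIdeal_eq_span L hLlin hLhom (by omega) hzspan).height_eq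
    have hh3 : height (i.left.base z₃) = (2 : ℕ) := by
      rw [height_base_eq_of_isClosedImmersion' i.left z₃, h₃]
    rw [hh3] at hh
    have : (2 : ℕ) = d + 1 - c := by exact_mod_cast hh
    omega
  have hz₃pl : IsLinearSubspacePoint 2 (d + 1) i z₃ := by
    have h := isLinearSubspacePoint_of_toIdeal_base_eq_span (i := i) (Fin.snoc L q) hqlin
      (isHomogeneous_one_snoc hLhom ((mem_homogeneousSubmodule 1 q).1 hq)) (by omega) hz₃
    rwa [show d + 1 - (c + 1) = 2 by omega] at h
  rw [← hsum]
  refine AddSubgroup.add_mem _ (AddSubgroup.add_mem _ (AddSubgroup.subset_closure ⟨z₁, hz₁pl, rfl⟩)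
    (AddSubgroup.subset_closure ⟨z₂, hz₂pl, rfl⟩)) (AddSubgroup.subset_closure ⟨z₃, hz₃pl, rfl⟩)

end Hypersurface

end Literature.AlgebraicGeometry.Motives

end
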